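import Mathlib.Data.Real.Basic
import Mathlib.Data.Nat.Choose.Basic
import Mathlib.Algebra.BigOperators.Ring.Finset
import Mathlib.Algebra.BigOperators.Pi
import Mathlib.Data.Fintype.BigOperators
import Mathlib.Order.Interval.Finset.Nat
import Mathlib.Algebra.Order.BigOperators.Group.Finset

/-!
# Route OneSlice, crux `SliceACZero` (stmt-PneNP-2835): vocabulary of the line `russo-window-ladder` (definitions)

Objects used by the line `russo-window-ladder` for the crux `Summit.PneNP.PneNP.Theses.OneSlice.SliceACZero`
(skeleton `Summits/PneNP/PneNP/Cruxes/SliceACZero/Lines/russo-window-ladder.lean`, whose registered stubs are stated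
in exactly this vocabulary and namespace). Everything lives on an ARBITRARY finite cube `ι → Bool` (the crux's
circuits read the edge set `(⊤ : SimpleGraph (Fin n)).edgeSet`, the Fourier side of the tree reads `Fin m`; the stubs
quantify over `ι` and the transports are paid once), with real-valued finite sums (no measure theory, no `PMF`):

* `wt x` — the number of ones of `x : ι → Bool` (on `Fin n` this is `Literature.Computability.Complexity.hammingWeight`,
  on edge vectors `Literature.Computability.Complexity.edgeCount`, both definitionally; kept general in `ι`);
* `prodWeight q x = q^{|x|}(1−q)^{N−|x|}` — the `μ_q`-weight of a point (`N = Fintype.card ι`; the `Finset` form is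
  `Literature.Combinatorics.SetFamily.biasedWeight`, the edge-vector form `gnpWeight`);
* `prodAvg q f = Pr_{μ_q}[f = 1]`, `sliceAvg f ℓ` = fraction of the Hamming slice `{|x| = ℓ}` where `f = 1`
  (count / count, so that on edge vectors numerator and denominator are the Disproof's `sliceErr` / `sliceCard`);
* `upPivotal f` — the bichromatic UP-edges `(x, i)` of the cube (`x_i = 0`, `f x ≠ f (x with x_i := 1)`), and
  `biasedInfluence q f = Σ_{(x,i) ∈ upPivotal f} q^{|x|}(1−q)^{N−1−|x|}` — the unsigned `μ_q`-total influence
  `Σ_i Pr_{μ_q}[i pivotal]` (O'Donnell 2014 §8.4; at `q = 1/2` the ordinary total influence `#upPivotal · 2^{1−N}`);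
* `binomPMF N q ℓ = C(N,ℓ) q^ℓ (1−q)^{N−ℓ}` and the HYBRID WEIGHT `hybridWeight N q j i` of the edge layer `i → i+1`
  seen from slice `j` (`P[Bin(N,q) ≥ i+1]` if `j ≤ i`, `P[Bin(N,q) ≤ i]` if `i < j`; Filmus–Mossel hybrid argument).

Definitions and their one-line API only (nonnegativity, product form, total mass); the stubs and the composition live
in the skeleton and land as `OneSliceSliceACZero*.lean`. [folklore]
-/

noncomputable section

namespace Summit.PneNP.PneNP.Cruxes.SliceACZero.RussoWindowLadder

open scoped BigOperators
open Finset

set_option linter.dupNamespace false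

section Vocabulary

variable {ι : Type} [Fintype ι] [DecidableEq ι]

/-- `|x|`: the number of ones of `x` (Hamming weight on an arbitrary finite index type; on `Fin n` it is
`hammingWeight`, on edge vectors `edgeCount`, definitionally). [folklore] -/
def wt (x : ι → Bool) : ℕ := #(univ.filter fun i => x i = true)

/-- The `μ_q` (product, `q`-biased) weight of a point: `q^{|x|}(1−q)^{N−|x|}`, `N = Fintype.card ι`. [folklore] -/
def prodWeight (q : ℝ) (x : ι → Bool) : ℝ := q ^ wt x * (1 - q) ^ (Fintype.card ι - wt x)

/-- `E_{μ_q}[f] = Pr_{μ_q}[f = 1]` as a finite sum. [folklore] -/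
def prodAvg (q : ℝ) (f : (ι → Bool) → Bool) : ℝ :=
  ∑ x ∈ univ.filter (fun x : ι → Bool => f x = true), prodWeight q x

/-- `a_ℓ(f)`: the fraction of the Hamming slice `{|x| = ℓ}` on which `f = 1` (count / count; `0` on an empty
slice by `x / 0 = 0`). [folklore] -/
def sliceAvg (f : (ι → Bool) → Bool) (ℓ : ℕ) : ℝ :=
  (#(univ.filter fun x : ι → Bool => wt x = ℓ ∧ f x = true) : ℝ) / (#(univ.filter fun x : ι → Bool => wt x = ℓ) : ℝ)

/-- The bichromatic UP-edges of `f`: pairs `(x, i)` with `x_i = 0` and `f x ≠ f (x with x_i := 1)` (each pivotal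
hypercube edge counted once, from its lower endpoint). [folklore] -/
def upPivotal (f : (ι → Bool) → Bool) : Finset ((ι → Bool) × ι) :=
  univ.filter fun p => p.1 p.2 = false ∧ f p.1 ≠ f (Function.update p.1 p.2 true)

/-- The UNSIGNED `μ_q`-total influence `I_q(f) = Σ_i Pr_{x ∼ μ_q}[i pivotal for f at x]`, written as the sum over
up-pivotal edges `(x,i)` of the `μ_q`-weight of `x` off coordinate `i`, `q^{|x|}(1−q)^{N−1−|x|}`; at `q = 1/2` this is
the ordinary total influence `I[f] = #upPivotal(f) · 2^{1−N}` (O'Donnell 2014, §2.2 and §8.4). [folklore] -/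
def biasedInfluence (q : ℝ) (f : (ι → Bool) → Bool) : ℝ :=
  ∑ p ∈ upPivotal f, q ^ wt p.1 * (1 - q) ^ (Fintype.card ι - 1 - wt p.1)

end Vocabulary

/-- The binomial point mass `P[Bin(N,q) = ℓ] = C(N,ℓ) q^ℓ (1−q)^{N−ℓ}` (as a real number, any real `q`). [folklore] -/
def binomPMF (N : ℕ) (q : ℝ) (ℓ : ℕ) : ℝ := (N.choose ℓ : ℝ) * q ^ ℓ * (1 - q) ^ (N - ℓ)

/-- The HYBRID WEIGHT of the edge layer `i → i+1` seen from slice `j`: the `Bin(N,q)`-mass strictly above `i` if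
`j ≤ i`, the mass at or below `i` if `i < j` (the mass of the levels `ℓ` whose monotone path from `j` to `ℓ` crosses
the layer; Filmus–Mossel, *Harmonicity and invariance on slices of the Boolean cube*, §8). [folklore] -/
def hybridWeight (N : ℕ) (q : ℝ) (j i : ℕ) : ℝ :=
  if j ≤ i then ∑ ℓ ∈ Finset.Ioc i N, binomPMF N q ℓ else ∑ ℓ ∈ Finset.range (i + 1), binomPMF N q ℓ

/-! ### One-line API -/

section API

variable {ι : Type} [Fintype ι]

/-- A point with a zero coordinate has weight `< N`. [folklore] -/
theorem wt_lt_card_of_mem_upPivotal [DecidableEq ι] {f : (ι → Bool) → Bool} {p : (ι → Bool) × ι}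
    (hp : p ∈ upPivotal f) : wt p.1 < Fintype.card ι := by
  rw [upPivotal, mem_filter] at hp
  rw [wt, ← Finset.card_univ (α := ι)]
  refine Finset.card_lt_card (Finset.filter_ssubset.2 ⟨p.2, mem_univ _, ?_⟩)
  rw [hp.2.1]
  exact Bool.false_ne_true

/-- The weight is at most `N`. [folklore] -/
theorem wt_le_card [DecidableEq ι] (x : ι → Bool) : wt x ≤ Fintype.card ι := by
  rw [wt, ← Finset.card_univ (α := ι)]
  exact Finset.card_filter_le _ _

/-- `μ_q` weights are nonnegative for `q ∈ [0,1]`. [folklore] -/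
theorem prodWeight_nonneg [DecidableEq ι] {q : ℝ} (hq0 : 0 ≤ q) (hq1 : q ≤ 1) (x : ι → Bool) :
    0 ≤ prodWeight q x :=
  mul_nonneg (pow_nonneg hq0 _) (pow_nonneg (sub_nonneg.2 hq1) _)

/-- Product form of the `μ_q` weight. [folklore] -/
theorem prodWeight_eq_prod [DecidableEq ι] (q : ℝ) (x : ι → Bool) :
    prodWeight q x = ∏ i, (if x i = true then q else 1 - q) := by
  have hc : #(univ.filter fun i => ¬ x i = true) = Fintype.card ι - wt x := by
    have h := Finset.card_filter_add_card_filter_not (s := (univ : Finset ι)) (fun i => x i = true)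
    rw [Finset.card_univ] at h
    rw [wt]
    omega
  rw [Finset.prod_ite, Finset.prod_const, Finset.prod_const, hc]
  rfl

/-- Total mass `Σ_x μ_q(x) = 1` (any real `q`). [folklore] -/
theorem sum_prodWeight [DecidableEq ι] (q : ℝ) : ∑ x : ι → Bool, prodWeight q x = 1 := by
  simp_rw [prodWeight_eq_prod]
  have h := Finset.prod_univ_sum (fun _ : ι => (Finset.univ : Finset Bool)) (fun _ b => if b = true then q else 1 - q)
  rw [Fintype.piFinset_univ] at h
  rw [← h]
  simp

/-- Binomial point masses are nonnegative for `q ∈ [0,1]`. [folklore] -/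
theorem binomPMF_nonneg (N : ℕ) {q : ℝ} (hq0 : 0 ≤ q) (hq1 : q ≤ 1) (ℓ : ℕ) : 0 ≤ binomPMF N q ℓ :=
  mul_nonneg (mul_nonneg (Nat.cast_nonneg _) (pow_nonneg hq0 _)) (pow_nonneg (sub_nonneg.2 hq1) _)

/-- Hybrid weights are nonnegative for `q ∈ [0,1]`. [folklore] -/
theorem hybridWeight_nonneg (N : ℕ) {q : ℝ} (hq0 : 0 ≤ q) (hq1 : q ≤ 1) (j i : ℕ) : 0 ≤ hybridWeight N q j i := by
  unfold hybridWeight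
  split_ifs <;> exact Finset.sum_nonneg fun ℓ _ => binomPMF_nonneg N hq0 hq1 ℓ

end API

end Summit.PneNP.PneNP.Cruxes.SliceACZero.RussoWindowLadder

end
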